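import Literature.NumberTheory.PAdicHodge.FormalLogSecondKindTransport
import Mathlib.RingTheory.MvPowerSeries.Expand
import Mathlib.Algebra.CharP.Quotient
import HarnessLib

/-!
# The Frobenius partner `log_{E₀}(Xᵖ)` is of the second kind on every formal group congruent to `Ê₀`:
# `‖[X^d](log_{E₀}(F_W(X,Y)ᵖ) − log_{E₀}(Xᵖ) − log_{E₀}(Yᵖ))‖ ≤ max(M_p, M_c)` when `W ≡ E₀ (mod c)` and `W^{(p)} ≡ E₀ (mod c)`

Topic `Literature/NumberTheory/PAdicHodge` (theorems only; no definition, no named fact, no instance, no `sorry`). Sequel of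
`FormalLogSecondKindTransport` (`log_{E₀}` is of the second kind on `Ŵ` for `W ≡ E₀ (mod c)`). Setting: `K` a non-archimedean normed field of
characteristic `0`, `φ : R → K` of norm `≤ 1`, `p` a prime which is NOT a unit of `R` (e.g. `R = 𝒪_D = ℤ_p[ϖ]`), `W/R` a Weierstrass equation,
`W^{(p)} := ⟨a₁ᵖ, …, a₆ᵖ⟩` its FROBENIUS TWIST (a lift of `(W ⊗ R/p)^{(p)}`), `E₀/ℤ` with `W^{(p)} ≡ E₀ ⊗ R (mod c)` (for `𝒪_D` with residue field `𝔽_p`: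
`aᵖ ≡ a (mod ϖ)`, so this is the same congruence as `W ≡ E₀ (mod ϖ)`). Write `ℓ = log_{E₀} ∈ K⟦X⟧`, `F = F_W ∈ K⟦X,Y⟧`.

* §1 `norm_coeff_expand_le` (`expand p` — `X_i ↦ X_iᵖ` — preserves coefficient bounds), `subst_expand_eq_expand_subst` (`ℓ(expand G) = expand(ℓ(G))`);
* §2 `exists_formalGroupLaw_pow_sub_expand_eq_C_mul` — **`F_Wᵖ − expand_p(F_{W'}) ∈ p·R⟦X,Y⟧`** (Frobenius in characteristic `p`:
  `F̄ᵖ = F̄^{(p)}(Xᵖ,Yᵖ)`, Mathlib `MvPowerSeries.map_frobenius_expand`, and `F_{W ⊗ R/p}^{(p)} = F_{(W ⊗ R/p)^{(p)}}`, tree `map_formalGroupLaw`);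
  `norm_coeff_map_formalGroupLaw_pow_sub_expand_le` — its `K`-reading `‖[X^d](Fᵖ − expand F_{W'})‖ ≤ ‖p‖`;
* §3 ★★ `norm_coeff_formalLog_pow_cocycle_le` — **`‖[X^d](ℓ(Fᵖ) − ℓ(X₀ᵖ) − ℓ(X₁ᵖ))‖ ≤ max(M_p, M_c)`** whenever `‖p‖^j ≤ M_p‖j‖` and
  `‖φ c‖^j ≤ M_c‖j‖` (`j ≥ 1`): the series `g = ℓ(Xᵖ)` — whose periods along a tower are those of the φ-PARTNER `φΛ` of the `A_max`-period `Λ`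
  (`θ∘φ[·]` raises the coordinate to the `p`-th power) — is of the second kind on `Ŵ`. Proof: `ℓ(Fᵖ) − ℓ(expand F_{W'})` is `M_p`-bounded by
  `LogTypeSubstCongruence` (`Fᵖ ≡ expand F_{W'} (mod p)`), and `ℓ(expand F_{W'}) − ℓ(X₀ᵖ) − ℓ(X₁ᵖ) = expand(∂_{W'}ℓ)` is `M_c`-bounded by
  `norm_coeff_formalLog_cocycle_le` for `W'`.

Purpose (line `kato_lever`, crux K★ `stmt-BirchSwinnertonDyer-22226`, memo `Lines/kato-lever-K2-ramified-cm-transport.md` §5–§6, step T4): together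
with `norm_coeff_formalLog_cocycle_le`, BOTH generators `log_{E₀}`, `log_{E₀}(Xᵖ)` of the crystalline frame transported from the CM fibre `E₀` are
functions of the second kind on the ramified good model `Ŵ_D`, so that the named residue (H2) (`KatzSecondKindRank`) applies to
`G = β·log_{E₀} − α·log_{E₀}(Xᵖ)`. BSD / K★ are not proved by any of this; nothing about elliptic curves over number fields is proved here.

## References
* N. M. Katz, *Crystalline cohomology, Dieudonné modules, and Jacobi sums* (1981), Key Lemma 5.1.3, Thm. 5.1.4 (the Frobenius `F(f) = f^σ(Xᵖ)` on
  `D(G/R)` via the lift `X ↦ Xᵖ` of the relative Frobenius). [Katz1981CrystallineDieudonne]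
* T. Honda, *On the theory of commutative formal groups*, J. Math. Soc. Japan 22 (1970), Lemma 2.3, §2 (`f ↦ f^σ(x^q)`). [Honda1970]
* J. H. Silverman, *The Arithmetic of Elliptic Curves* (2009), IV.1, IV.5. [SilvermanAEC2009]
-/

noncomputable section

open scoped Classical
open PowerSeries

namespace Literature.NumberTheory.PAdicHodge

open Literature.RingTheory.FormalGroups

variable {K : Type*} [NormedField K] [IsUltrametricDist K] [CharZero K]
  {R : Type*} [CommRing R] (φ : R →+* K) {p : ℕ} [hp : Fact p.Prime]

/-! ## §1 `expand` preserves coefficient bounds and commutes with substitution -/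

omit [IsUltrametricDist K] [CharZero K] in
/-- `expand p` (`X_i ↦ X_iᵖ`) preserves coefficient bounds: its coefficients are coefficients of the original series or `0`.
[cite: Honda1970, §2] -/
theorem norm_coeff_expand_le {σ : Type*} (G : MvPowerSeries σ K) {B : ℝ} (hB : 0 ≤ B) (hG : ∀ d, ‖MvPowerSeries.coeff d G‖ ≤ B)
    (d : σ →₀ ℕ) : ‖MvPowerSeries.coeff d (MvPowerSeries.expand p hp.out.ne_zero G)‖ ≤ B := by
  by_cases h : ∀ i, p ∣ d i
  · -- `d = p • m`
    obtain ⟨m, hm⟩ : ∃ m : σ →₀ ℕ, d = p • m := by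
      refine ⟨d.mapRange (· / p) (Nat.zero_div p), Finsupp.ext fun i => ?_⟩
      rw [Finsupp.smul_apply, Finsupp.mapRange_apply, smul_eq_mul, Nat.mul_div_cancel' (h i)]
    rw [hm, MvPowerSeries.coeff_expand_smul]
    exact hG m
  · obtain ⟨i, hi⟩ := not_forall.mp h
    rw [MvPowerSeries.coeff_expand_of_not_dvd p hp.out.ne_zero G hi, norm_zero]
    exact hB

omit [IsUltrametricDist K] [CharZero K] in
/-- `ℓ(expand G) = expand(ℓ(G))` for a one-variable `ℓ` substituted at a constant-term-free multivariable `G` (`expand` is the substitution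
`X_i ↦ X_iᵖ`, and substitutions compose). [cite: Honda1970, §2] -/
theorem subst_expand_eq_expand_subst {σ : Type*} (ℓ : PowerSeries K) {G : MvPowerSeries σ K} (hG : MvPowerSeries.constantCoeff G = 0) :
    ℓ.subst (MvPowerSeries.expand p hp.out.ne_zero G) = MvPowerSeries.expand p hp.out.ne_zero (ℓ.subst G) := by
  rw [MvPowerSeries.expand, MvPowerSeries.coe_substAlgHom, PowerSeries.subst, PowerSeries.subst,
    MvPowerSeries.subst_comp_subst_apply (PowerSeries.HasSubst.of_constantCoeff_zero hG).const
      (MvPowerSeries.HasSubst.X_pow hp.out.ne_zero)]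

/-! ## §2 `F_Wᵖ ≡ expand_p F_{W'} (mod p)` for a lift `W'` of the Frobenius twist of `W ⊗ R/p` -/

/-- ★ **Frobenius on the chord–tangent law**: if `W' ⊗ R/p = (W ⊗ R/p)^{(p)}` (coefficientwise `p`-th powers) and `p` is not a unit of `R`, then
`F_Wᵖ − expand_p(F_{W'}) ∈ p·R⟦X,Y⟧` — in characteristic `p`, `F̄(X,Y)ᵖ = F̄^{(p)}(Xᵖ,Yᵖ)` and `F̄^{(p)}` is the law of the Frobenius-twisted
equation. [cite: Katz1981CrystallineDieudonne, Thm. 5.1.4] [cite: SilvermanAEC2009, IV.1] -/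
theorem exists_formalGroupLaw_pow_sub_expand_eq_C_mul (hunit : ¬ IsUnit (p : R)) (W : WeierstrassCurve R) :
    ∃ G : MvPowerSeries (Fin 2) R,
      W.formalGroupLaw ^ p - MvPowerSeries.expand p hp.out.ne_zero
        (⟨W.a₁ ^ p, W.a₂ ^ p, W.a₃ ^ p, W.a₄ ^ p, W.a₆ ^ p⟩ : WeierstrassCurve R).formalGroupLaw = MvPowerSeries.C (p : R) * G := by
  haveI : CharP (R ⧸ Ideal.span {(p : R)}) p := CharP.quotient R p hunit
  haveI : ExpChar (R ⧸ Ideal.span {(p : R)}) p := ExpChar.prime hp.out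
  set π := Ideal.Quotient.mk (Ideal.span {(p : R)}) with hπ
  set W' : WeierstrassCurve R := ⟨W.a₁ ^ p, W.a₂ ^ p, W.a₃ ^ p, W.a₄ ^ p, W.a₆ ^ p⟩ with hW'def
  have hW' : W'.map π = (W.map π).map (frobenius (R ⧸ Ideal.span {(p : R)}) p) := by
    ext <;> simp [hW'def, WeierstrassCurve.map, frobenius_def]
  have hkey : MvPowerSeries.map π (W.formalGroupLaw ^ p - MvPowerSeries.expand p hp.out.ne_zero W'.formalGroupLaw) = 0 := by
    rw [map_sub, map_pow, MvPowerSeries.map_expand, W'.map_formalGroupLaw π, hW', ← (W.map π).map_formalGroupLaw (frobenius _ p),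
      ← MvPowerSeries.map_expand, MvPowerSeries.map_frobenius_expand, W.map_formalGroupLaw π, sub_self]
  have hcoeff : ∀ d, (p : R) ∣ MvPowerSeries.coeff d (W.formalGroupLaw ^ p - MvPowerSeries.expand p hp.out.ne_zero W'.formalGroupLaw) := fun d => by
    rw [← Ideal.mem_span_singleton, ← Ideal.Quotient.eq_zero_iff_mem, ← hπ, ← MvPowerSeries.coeff_map, hkey, map_zero]
  refine ⟨fun d => Classical.choose (hcoeff d), MvPowerSeries.ext fun d => ?_⟩
  rw [MvPowerSeries.coeff_C_mul]
  exact Classical.choose_spec (hcoeff d)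

omit [IsUltrametricDist K] [CharZero K] in
/-- Its `K`-reading: **`‖[X^d]((F_W)ᵖ − expand_p F_{W'})‖ ≤ ‖p‖`** (`‖φ‖ ≤ 1`). [cite: Katz1981CrystallineDieudonne, Thm. 5.1.4] -/
theorem norm_coeff_map_formalGroupLaw_pow_sub_expand_le (hφ : ∀ x, ‖φ x‖ ≤ 1) (hunit : ¬ IsUnit (p : R)) (W : WeierstrassCurve R)
    (d : Fin 2 →₀ ℕ) :
    ‖MvPowerSeries.coeff d (MvPowerSeries.map φ W.formalGroupLaw ^ p -
        MvPowerSeries.expand p hp.out.ne_zero (MvPowerSeries.map φ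
          (⟨W.a₁ ^ p, W.a₂ ^ p, W.a₃ ^ p, W.a₄ ^ p, W.a₆ ^ p⟩ : WeierstrassCurve R).formalGroupLaw))‖ ≤ ‖(p : K)‖ := by
  obtain ⟨G, hG⟩ := exists_formalGroupLaw_pow_sub_expand_eq_C_mul hunit W
  have h : MvPowerSeries.map φ W.formalGroupLaw ^ p - MvPowerSeries.expand p hp.out.ne_zero (MvPowerSeries.map φ
        (⟨W.a₁ ^ p, W.a₂ ^ p, W.a₃ ^ p, W.a₄ ^ p, W.a₆ ^ p⟩ : WeierstrassCurve R).formalGroupLaw) =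
      MvPowerSeries.map φ (W.formalGroupLaw ^ p - MvPowerSeries.expand p hp.out.ne_zero
        (⟨W.a₁ ^ p, W.a₂ ^ p, W.a₃ ^ p, W.a₄ ^ p, W.a₆ ^ p⟩ : WeierstrassCurve R).formalGroupLaw) := by
    rw [map_sub, map_pow, MvPowerSeries.map_expand]
  rw [h, hG, MvPowerSeries.coeff_map, MvPowerSeries.coeff_C_mul, map_mul, map_natCast, norm_mul]
  exact mul_le_of_le_one_right (norm_nonneg _) (hφ _)

/-! ## §3 The coboundary of `log_{E₀}(Xᵖ)` for `⊕_W` is bounded -/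

/-- ★★ **`log_{E₀}(Xᵖ)` is of the second kind for `Ŵ`**: with `ℓ = log_{E₀} ∈ K⟦X⟧`, `F = F_W` read in `K`, `W^{(p)} = ⟨aᵢᵖ⟩` the Frobenius twist
with `W^{(p)} ≡ E₀ ⊗ R (mod c)`, and constants `M_p, M_c ≥ 0` with `‖p‖^j ≤ M_p‖j‖`, `‖φ c‖^j ≤ M_c‖j‖` (`j ≥ 1`):
`‖[X^d](ℓ(Fᵖ) − ℓ(X₀ᵖ) − ℓ(X₁ᵖ))‖ ≤ max(M_p, M_c)` for every `d`. (Katz's Frobenius `f ↦ f(Xᵖ)` on `D(G/R)`, transported along `W ≡ E₀`, in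
bounded form.) [cite: Katz1981CrystallineDieudonne, Key Lemma 5.1.3 and Thm. 5.1.4] [cite: Honda1970, Lemma 2.3] -/
theorem norm_coeff_formalLog_pow_cocycle_le (hφ : ∀ x, ‖φ x‖ ≤ 1) (hunit : ¬ IsUnit (p : R)) (c : R) (W : WeierstrassCurve R)
    (E₀ : WeierstrassCurve ℤ)
    (hW'E : (⟨W.a₁ ^ p, W.a₂ ^ p, W.a₃ ^ p, W.a₄ ^ p, W.a₆ ^ p⟩ : WeierstrassCurve R).map (Ideal.Quotient.mk (Ideal.span {c})) =
      (E₀.map (algebraMap ℤ R)).map (Ideal.Quotient.mk (Ideal.span {c})))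
    {Mp Mc : ℝ} (hMp0 : 0 ≤ Mp) (hMc0 : 0 ≤ Mc) (hMp : ∀ j : ℕ, 1 ≤ j → ‖(p : K)‖ ^ j ≤ Mp * ‖(j : K)‖)
    (hMc : ∀ j : ℕ, 1 ≤ j → ‖φ c‖ ^ j ≤ Mc * ‖(j : K)‖) (d : Fin 2 →₀ ℕ) :
    ‖MvPowerSeries.coeff d ((E₀.map (Int.castRingHom K)).formalLog.subst (MvPowerSeries.map φ W.formalGroupLaw ^ p) -
        (E₀.map (Int.castRingHom K)).formalLog.subst ((MvPowerSeries.X 0 : MvPowerSeries (Fin 2) K) ^ p) -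
        (E₀.map (Int.castRingHom K)).formalLog.subst ((MvPowerSeries.X 1 : MvPowerSeries (Fin 2) K) ^ p))‖ ≤ max Mp Mc := by
  set ℓ := (E₀.map (Int.castRingHom K)).formalLog with hℓ
  set F := MvPowerSeries.map φ W.formalGroupLaw with hF
  set W' : WeierstrassCurve R := ⟨W.a₁ ^ p, W.a₂ ^ p, W.a₃ ^ p, W.a₄ ^ p, W.a₆ ^ p⟩ with hW'def
  set F' := MvPowerSeries.map φ W'.formalGroupLaw with hF'
  have hp0 : p ≠ 0 := hp.out.ne_zero
  have hF'0 : MvPowerSeries.constantCoeff F' = 0 := by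
    rw [hF', MvPowerSeries.constantCoeff_map, W'.constantCoeff_formalGroupLaw, map_zero]
  have hF0 : MvPowerSeries.constantCoeff F = 0 := by
    rw [hF, MvPowerSeries.constantCoeff_map, W.constantCoeff_formalGroupLaw, map_zero]
  -- `expand` of the `W'`-cocycle of `ℓ`
  have hexp : ℓ.subst (MvPowerSeries.expand p hp0 F') - ℓ.subst ((MvPowerSeries.X 0 : MvPowerSeries (Fin 2) K) ^ p) -
      ℓ.subst ((MvPowerSeries.X 1 : MvPowerSeries (Fin 2) K) ^ p) =
      MvPowerSeries.expand p hp0 (ℓ.subst F' - ℓ.subst (MvPowerSeries.X 0 : MvPowerSeries (Fin 2) K) -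
        ℓ.subst (MvPowerSeries.X 1 : MvPowerSeries (Fin 2) K)) := by
    rw [map_sub, map_sub, ← subst_expand_eq_expand_subst ℓ hF'0,
      ← subst_expand_eq_expand_subst ℓ (MvPowerSeries.constantCoeff_X 0), ← subst_expand_eq_expand_subst ℓ (MvPowerSeries.constantCoeff_X 1),
      MvPowerSeries.expand_X, MvPowerSeries.expand_X]
  -- split
  have hsplit : ℓ.subst (F ^ p) - ℓ.subst ((MvPowerSeries.X 0 : MvPowerSeries (Fin 2) K) ^ p) -
      ℓ.subst ((MvPowerSeries.X 1 : MvPowerSeries (Fin 2) K) ^ p) =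
      (ℓ.subst (F ^ p) - ℓ.subst (MvPowerSeries.expand p hp0 F')) +
        MvPowerSeries.expand p hp0 (ℓ.subst F' - ℓ.subst (MvPowerSeries.X 0 : MvPowerSeries (Fin 2) K) -
          ℓ.subst (MvPowerSeries.X 1 : MvPowerSeries (Fin 2) K)) := by
    rw [← hexp]; ring
  rw [hsplit, map_add]
  refine (IsUltrametricDist.norm_add_le_max _ _).trans (max_le_max ?_ ?_)
  · -- `ℓ(Fᵖ) − ℓ(expand F')`: arguments congruent mod `p`
    refine norm_coeff_subst_sub_subst_le_of_logType (norm_natCast_mul_coeff_formalLog_map_le_one E₀) ?_ ?_ ?_ (norm_nonneg (p : K)) hMp0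
      (fun d' => norm_coeff_map_formalGroupLaw_pow_sub_expand_le φ hφ hunit W d') hMp d
    · rw [map_pow, hF0, zero_pow hp0]
    · rw [MvPowerSeries.constantCoeff_expand, hF'0]
    · exact norm_coeff_expand_le F' zero_le_one (norm_coeff_map_formalGroupLaw_le_one φ hφ W') 
  · exact norm_coeff_expand_le _ hMc0 (norm_coeff_formalLog_cocycle_le φ hφ c W' E₀ hW'E hMc0 hMc) d

end Literature.NumberTheory.PAdicHodge
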